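import Literature.Computability.Complexity.SymmetricThresholdProgramsDAG
import HarnessLib

/-!
# Symmetric threshold programs: symmetries and compilation to symmetric circuits

Companion of `SymmetricThresholdPrograms.lean` / `SymmetricThresholdProgramsDAG.lean`.  A SYMMETRY of a program `P : SymProg ι Λ` over an
input map `π : ι → ι` is a relabelling `θ : Λ ≃ Λ` of the logical gates that preserves kinds and
carries the source SET of `l` onto the source set of `θ l` (`SymProg.IsSym`).  Because the
realisation `P.toDAG` reads sources as sets (through padded symmetric gates), every symmetry is an
automorphism of the realised DAG (`SymProg.isAut_toDAG`) — no argument about wires or argument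
orders is ever needed again.  Consequences:

* `SymProg.sem_symm` — the semantics is invariant: `P.sem x (θ l) = P.sem (x ∘ π) l`;
* `SymProg.isSymm_toDAG`, `SymProg.hasSymCircuit` — for matrix inputs `Fin m × Fin m` and a set `Γ`
  of permutations of `Fin m` each of which (acting diagonally on the inputs) extends to a symmetry
  fixing the output wire, the program is a `Γ`-symmetric threshold circuit of size `2·|Λ| + 2`
  computing its semantics (`HasSymCircuit tcBasis Γ (2·|Λ|+2) _`), the currency of the symmetric
  circuit items of `PneNP/SymmetryBudget` (Anderson–Dawar 2017, §3: the compilation step of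
  FPC-to-symmetric-circuit translations).

## References
* M. Anderson, A. Dawar, *On symmetric circuits and fixed-point logics*, Theory Comput. Syst. 60
  (2017), §2–3 [AndersonDawar2016].
* A. Dawar, G. Wilsenach, *Symmetric arithmetic circuits*, ToC 2025, §3 [DawarWilsenach2025].
-/

namespace Literature.Computability.Complexity

open Finset

namespace SymProg

variable {ι Λ : Type*} (P : SymProg ι Λ)

/-! ### Relabelling physical gates and wires -/

/-- The relabelling of physical gates induced by a relabelling of logical gates. [folklore] -/
def nodePerm (θ : Λ ≃ Λ) : Node Λ ≃ Node Λ :=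
  Equiv.sumCongr (Equiv.prodCongr θ (Equiv.refl Bool)) (Equiv.refl Bool)

/-- The relabelling of physical wires. [folklore] -/
abbrev pmap (π : ι → ι) (θ : Λ ≃ Λ) : Wire ι Λ → Wire ι Λ := Sum.map π (nodePerm θ)

/-- Naturality of `wmap`. [folklore] -/
theorem pmap_wmap (π : ι → ι) (θ : Λ ≃ Λ) (w : ι ⊕ Λ) :
    pmap π θ (wmap w) = wmap (Sum.map π θ w) := by
  cases w <;> rfl

/-- Constants are fixed. [folklore] -/
theorem pmap_cst (π : ι → ι) (θ : Λ ≃ Λ) (b : Bool) : pmap π θ (cst b : Wire ι Λ) = cst b := rfl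

/-- Pre-gate wires are relabelled. [folklore] -/
theorem pmap_preW (π : ι → ι) (θ : Λ ≃ Λ) (l : Λ) : pmap π θ (preW l : Wire ι Λ) = preW (θ l) := rfl

/-- Padding wires are fixed. [folklore] -/
theorem pmap_pad (π : ι → ι) (θ : Λ ≃ Λ) (n t : ℕ) (j : Fin (n + 1)) :
    pmap π θ (pad n t j : Wire ι Λ) = pad n t j := by
  unfold pad; split_ifs <;> rfl

/-- Padding lists are fixed. [folklore] -/
theorem map_pmap_ofFn_pad (π : ι → ι) (θ : Λ ≃ Λ) (n t : ℕ) :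
    (List.ofFn (pad n t : Fin (n + 1) → Wire ι Λ)).map (pmap π θ) = List.ofFn (pad n t) := by
  rw [List.map_ofFn]
  exact congrArg List.ofFn (funext fun j => pmap_pad π θ n t j)

/-- Padding lists of equal parameters are equal. [folklore] -/
theorem ofFn_pad_congr {n n' t t' : ℕ} (hn : n' = n) (ht : t' = t) :
    List.ofFn (pad n' t' : Fin (n' + 1) → Wire ι Λ) = List.ofFn (pad n t) := by
  subst hn; subst ht; rfl

/-- `pmap` is injective for injective `π`. [folklore] -/
theorem pmap_injective {π : ι → ι} (hπ : Function.Injective π) (θ : Λ ≃ Λ) :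
    Function.Injective (pmap π θ : Wire ι Λ → Wire ι Λ) :=
  Sum.map_injective.2 ⟨hπ, (nodePerm θ).injective⟩

/-- The relabelling of logical wires is injective for injective `π`. [folklore] -/
theorem smap_injective {π : ι → ι} (hπ : Function.Injective π) (θ : Λ ≃ Λ) :
    Function.Injective (Sum.map π θ : ι ⊕ Λ → ι ⊕ Λ) :=
  Sum.map_injective.2 ⟨hπ, θ.injective⟩

/-- Filtering an injective image. [folklore] -/
theorem card_filter_image_eq {α β : Type*} [DecidableEq β] (s : Finset α) {f : α → β}
    (hf : Function.Injective f) (p : β → Prop) [DecidablePred p] :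
    ((s.image f).filter p).card = (s.filter fun a => p (f a)).card := by
  rw [← Finset.card_image_of_injective (s.filter fun a => p (f a)) hf]
  congr 1
  ext b
  simp only [mem_filter, mem_image]
  constructor
  · rintro ⟨⟨a, ha, rfl⟩, hp⟩; exact ⟨a, ⟨ha, hp⟩, rfl⟩
  · rintro ⟨a, ⟨ha, hp⟩, rfl⟩; exact ⟨⟨a, ha, rfl⟩, hp⟩

variable [DecidableEq ι] [DecidableEq Λ]

/-! ### Symmetries of a program -/

/-- A **symmetry** of the program over the input map `π`: a relabelling `θ` of the logical gates
preserving kinds and carrying source sets to source sets. [cite: AndersonDawar2016, Def. 6] -/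
structure IsSym (π : ι → ι) (θ : Λ ≃ Λ) : Prop where
  /-- kinds are preserved -/
  kind_eq : ∀ l, P.kind (θ l) = P.kind l
  /-- the sources of `θ l` are the relabelled sources of `l` -/
  srcs_eq : ∀ l, P.srcs (θ l) = (P.srcs l).image (Sum.map π θ)

/-- A symmetry preserves the number of sources. [folklore] -/
theorem card_srcs_eq {π : ι → ι} {θ : Λ ≃ Λ} (h : P.IsSym π θ) (hπ : Function.Injective π) (l : Λ) :
    (P.srcs (θ l)).card = (P.srcs l).card := by
  rw [h.srcs_eq, Finset.card_image_of_injective _ (smap_injective hπ θ)]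

/-- **The semantics is invariant under symmetries**: the value of `θ l` on `x` is the value of `l`
on `x ∘ π`. [cite: AndersonDawar2016, §2.2] -/
theorem sem_symm {π : ι → ι} {θ : Λ ≃ Λ} (h : P.IsSym π θ) (hπ : Function.Injective π)
    (x : ι → Bool) (l : Λ) : P.sem x (θ l) = P.sem (x ∘ π) l := by
  induction hr : P.rank l using Nat.strong_induction_on generalizing l with
  | _ r ih =>
    rw [P.sem_eq_dec, P.sem_eq_dec _ l, h.kind_eq, P.card_srcs_eq h hπ]
    congr 1
    unfold cnt
    rw [h.srcs_eq, card_filter_image_eq _ (smap_injective hπ θ)]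
    congr 1
    refine Finset.filter_congr fun w hw => ?_
    cases w with
    | inl i => exact Iff.rfl
    | inr l' =>
      simp only [Sum.map_inr, wval_inr]
      rw [ih _ (hr ▸ P.rank_lt l l' hw) l' rfl]

/-! ### Symmetries are automorphisms of the realisation -/

/-- The enumerated sources of `θ l` are, up to order, the relabelled enumerated sources of `l`. [folklore] -/
theorem ofFn_enum_perm {π : ι → ι} {θ : Λ ≃ Λ} (h : P.IsSym π θ) (hπ : Function.Injective π) (l : Λ) :
    (List.ofFn (P.enum (θ l))).Perm ((List.ofFn (P.enum l)).map (pmap π θ)) := by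
  have d₁ : (List.ofFn (P.enum (θ l))).Nodup := List.nodup_ofFn.2 (P.enum_injective _)
  have d₂ : ((List.ofFn (P.enum l)).map (pmap π θ)).Nodup :=
    (List.nodup_ofFn.2 (P.enum_injective _)).map (pmap_injective hπ θ)
  refine (List.perm_ext_iff_of_nodup d₁ d₂).2 fun u => ?_
  rw [List.mem_ofFn', P.mem_range_enum, List.mem_map]
  constructor
  · rintro ⟨w', hw', rfl⟩
    rw [h.srcs_eq, mem_image] at hw'
    obtain ⟨w, hw, rfl⟩ := hw'
    exact ⟨wmap w, (List.mem_ofFn' _ _).2 (P.mem_range_enum.2 ⟨w, hw, rfl⟩), pmap_wmap π θ w⟩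
  · rintro ⟨b, hb, rfl⟩
    obtain ⟨w, hw, rfl⟩ := P.mem_range_enum.1 ((List.mem_ofFn' _ _).1 hb)
    refine ⟨Sum.map π θ w, ?_, (pmap_wmap π θ w).symm⟩
    rw [h.srcs_eq, mem_image]
    exact ⟨w, hw, rfl⟩

/-- The arguments of the pre-gate of `θ l` are, up to order, the relabelled arguments of the
pre-gate of `l`. [folklore] -/
theorem ofFn_preArgs_perm {π : ι → ι} {θ : Λ ≃ Λ} (h : P.IsSym π θ) (hπ : Function.Injective π)
    (l : Λ) : (List.ofFn (P.preArgs (θ l))).Perm ((List.ofFn (P.preArgs l)).map (pmap π θ)) := by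
  unfold preArgs
  rw [List.ofFn_fin_append, List.ofFn_fin_append, List.ofFn_cons, List.ofFn_cons, List.map_append,
    List.map_cons, pmap_cst, map_pmap_ofFn_pad,
    ofFn_pad_congr (P.card_srcs_eq h hπ l) (by rw [h.kind_eq, P.card_srcs_eq h hπ l])]
  exact ((P.ofFn_enum_perm h hπ l).cons _).append_right _

/-- **Every symmetry of the program fixing the output wire is an automorphism of its realisation.**
[cite: AndersonDawar2016, Def. 6] -/
theorem isAut_toDAG {π : ι → ι} {θ : Λ ≃ Λ} (h : P.IsSym π θ) (hπ : Function.Injective π)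
    {o : ι ⊕ Λ} (ho : Sum.map π θ o = o) : (P.toDAG o).IsAut π (nodePerm θ) := by
  refine ⟨?_, fun ν => ?_, fun ν => ?_⟩
  · show pmap π θ (wmap o) = wmap o
    rw [pmap_wmap, ho]
  · match ν with
    | Sum.inl (l, false) =>
      show GateFn.maj (((P.srcs (θ l)).card + 1) + ((P.srcs (θ l)).card + 1)) =
        GateFn.maj (((P.srcs l).card + 1) + ((P.srcs l).card + 1))
      rw [P.card_srcs_eq h hπ]
    | Sum.inl (l, true) =>
      show postFn (P.kind (θ l)) = postFn (P.kind l)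
      rw [h.kind_eq]
    | Sum.inr b => rfl
  · match ν with
    | Sum.inl (l, false) => exact P.ofFn_preArgs_perm h hπ l
    | Sum.inl (l, true) =>
      show (List.ofFn fun _ : Fin 1 => (preW (θ l) : Wire ι Λ)).Perm
        ((List.ofFn fun _ : Fin 1 => (preW l : Wire ι Λ)).map (pmap π θ))
      simp only [List.ofFn_succ, List.ofFn_zero, List.map_cons, List.map_nil, pmap_preW]
      exact List.Perm.refl _
    | Sum.inr b =>
      cases b
      · show (List.ofFn (Fin.elim0 : Fin 0 → Wire ι Λ)).Perm
          ((List.ofFn (Fin.elim0 : Fin 0 → Wire ι Λ)).map (pmap π θ))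
        simp
      · show (List.ofFn (Fin.elim0 : Fin 0 → Wire ι Λ)).Perm
          ((List.ofFn (Fin.elim0 : Fin 0 → Wire ι Λ)).map (pmap π θ))
        simp

/-- A set of input maps each extending to a symmetry fixing the output makes the realisation
symmetric. [cite: DawarWilsenach2025, Def. 3.7] -/
theorem isSymm_toDAG_of {M : Set (ι → ι)} {o : ι ⊕ Λ}
    (h : ∀ π ∈ M, Function.Injective π ∧ ∃ θ : Λ ≃ Λ, P.IsSym π θ ∧ Sum.map π θ o = o) :
    (P.toDAG o).IsSymm M := by
  intro π hπ
  obtain ⟨hinj, θ, hθ, ho⟩ := h π hπ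
  exact ⟨nodePerm θ, P.isAut_toDAG hθ hinj ho⟩

end SymProg

/-! ### Matrix inputs: compilation to symmetric threshold circuits -/

namespace SymProg

variable {Λ : Type*} [DecidableEq Λ] {m : ℕ} (Q : SymProg (Fin m × Fin m) Λ)

/-- The diagonal input map of a permutation of `Fin m`. [folklore] -/
abbrev diagMap (ρ : Equiv.Perm (Fin m)) : Fin m × Fin m → Fin m × Fin m := fun q => (ρ q.1, ρ q.2)

/-- Diagonal input maps are injective. [folklore] -/
theorem diagMap_injective (ρ : Equiv.Perm (Fin m)) : Function.Injective (diagMap ρ) := by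
  intro q q' hq
  simp only [diagMap, Prod.mk.injEq] at hq
  exact Prod.ext (ρ.injective hq.1) (ρ.injective hq.2)

/-- **Symmetry of the realisation** under a set `Γ` of permutations of `Fin m`, each of which —
acting diagonally on the matrix inputs — extends to a symmetry of the program fixing the output
wire. [cite: DawarWilsenach2025, Def. 3.7] -/
theorem isSymm_toDAG (Γ : Set (Equiv.Perm (Fin m))) (θ : Equiv.Perm (Fin m) → Λ ≃ Λ)
    (h : ∀ ρ ∈ Γ, Q.IsSym (diagMap ρ) (θ ρ)) {o : (Fin m × Fin m) ⊕ Λ}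
    (ho : ∀ ρ ∈ Γ, Sum.map (diagMap ρ) (θ ρ) o = o) :
    (Q.toDAG o).IsSymm (GateDAG.diagMaps Γ) := by
  rintro π ⟨ρ, hρ, rfl⟩
  exact ⟨nodePerm (θ ρ), Q.isAut_toDAG (h ρ hρ) (diagMap_injective ρ) (ho ρ hρ)⟩

/-- **Equivariant threshold programs are symmetric threshold circuits.**  If every `ρ ∈ Γ`, acting
diagonally on the matrix inputs, extends to a symmetry `θ ρ` of the program fixing the output wire
`o`, then the function computed at `o` has a `Γ`-symmetric circuit over the threshold basis with
`2·|Λ| + 2` gates. [cite: AndersonDawar2016, §3 (FPC to symmetric circuits)] -/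
theorem hasSymCircuit [Fintype Λ] (Γ : Set (Equiv.Perm (Fin m))) (θ : Equiv.Perm (Fin m) → Λ ≃ Λ)
    (h : ∀ ρ ∈ Γ, Q.IsSym (diagMap ρ) (θ ρ)) {o : (Fin m × Fin m) ⊕ Λ}
    (ho : ∀ ρ ∈ Γ, Sum.map (diagMap ρ) (θ ρ) o = o) :
    HasSymCircuit tcBasis Γ (2 * Fintype.card Λ + 2) fun x => wval x (Q.sem x) o :=
  ⟨(Q.toDAG o).compile, Q.compile_toDAG_isOver o, (Q.compile_toDAG_size o).le,
    ((Q.toDAG o).isSymmetricUnder_compile_iff Γ).2 (Q.isSymm_toDAG Γ θ h ho),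
    fun x => Q.compile_toDAG_eval o x⟩

/-- The common special case of an output GATE `l₀` fixed by every `θ ρ`. [folklore] -/
theorem hasSymCircuit_gate [Fintype Λ] (Γ : Set (Equiv.Perm (Fin m)))
    (θ : Equiv.Perm (Fin m) → Λ ≃ Λ) (h : ∀ ρ ∈ Γ, Q.IsSym (diagMap ρ) (θ ρ)) {l₀ : Λ}
    (hl₀ : ∀ ρ ∈ Γ, θ ρ l₀ = l₀) :
    HasSymCircuit tcBasis Γ (2 * Fintype.card Λ + 2) fun x => Q.sem x l₀ :=
  Q.hasSymCircuit Γ θ h (o := Sum.inr l₀) fun ρ hρ => by rw [Sum.map_inr, hl₀ ρ hρ]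

/-- **Invariance of the computed function**: for `ρ ∈ Γ`,
`Q.sem (x ∘ diagMap ρ) l = Q.sem x (θ ρ l)`. [folklore] -/
theorem sem_diag (Γ : Set (Equiv.Perm (Fin m))) (θ : Equiv.Perm (Fin m) → Λ ≃ Λ)
    (h : ∀ ρ ∈ Γ, Q.IsSym (diagMap ρ) (θ ρ)) {ρ : Equiv.Perm (Fin m)} (hρ : ρ ∈ Γ)
    (x : Fin m × Fin m → Bool) (l : Λ) : Q.sem (x ∘ diagMap ρ) l = Q.sem x (θ ρ l) :=
  (Q.sem_symm (h ρ hρ) (diagMap_injective ρ) x l).symm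

end SymProg

end Literature.Computability.Complexity
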